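import Summits.HodgeConjecture.HodgeConjecture.Theorems.K2E3WittLeviCartanRecursionTame   -- ★ p856461 (K2E3-p09): the (trace)+(norm) recursion; §1 diagonal tools reused
import HarnessLib

/-!
# Levi Cartan decomposition of `U(σ, J₀)` for ANY isometric involution modulo the RAW Cartan letter `hraw` (the conclusion shape of ★
# `HermitianLattice.exists_cartan_antidiagonal_of_trace_norm`, quantified over the size): the recursion of ★ `K2E3WittLeviCartanRecursionTame` (K2E3-p09)
# with (trace)+(norm) replaced by the letter (crux H413, 13a road A′ — the WILDLY RAMIFIED quasi-split places)

Cell `hodgecm-mathlib`, Track B, line `K2_E3_EllipticInputs`, 13a road A; seat K2E3-p10 (g3) (road-A line lead).  THEOREMS ONLY; count-neutral helper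
(`--supports stmt-HodgeConjecture-24833 --as helper`).  The mathematics is K2E3-p09 (g3)'s ★ p856461 VERBATIM; only the base case changes.

★ `K2E3WittLeviCartanRecursionTame.exists_leviIntegral_mul_diagonalGL_mul_of_trace_norm` uses (trace)+(norm) ONLY through the raw Cartan decomposition ★
`exists_cartan_antidiagonal_of_trace_norm` (`k₁ g k₂ = diag(d)`, `σ(d_i) d_{rev i} = 1`, `k₁, k₂ ∈ U(σ, J₀)` integral with integral inverses) of the
quasi-split group itself.  At a WILDLY ramified place neither (norm) nor a lattice proof is in the tree; K2E3-p09 (g3)'s «Cartan for any involution» by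
hermitian pivoting (★ `K2E3QuasiSplitUnitaryCartanAnyInvolutionStep` + sequel) delivers exactly the raw shape.  THIS FILE therefore takes the raw Cartan
decomposition FOR EVERY SIZE `N′` as a LETTER `hraw` (bare binders `hσ hvσ hϖ`, `ϖ` ANY uniformiser — not `σ`-fixed, ramified places included):

* §2 `exists_unitaryInt_mul_diagonalGL_mul_of_rawCartan` — the sorted Cartan decomposition of `U(σ, J₀)` from `hraw` at size `N` (★ p856461 §2 verbatim);
* §3 **`exists_leviIntegral_mul_diagonalGL_mul_of_rawCartan`** — `hraw ⟹` the Levi Cartan decomposition in diagonal form for every `S ⊆ Fin r` (★ p856461 §3).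

The sequel `K2E3WittCartanOfRawCartan` packages the `hG` ∕ `hLevi` letters of the 13a driver and discharges it modulo `hraw`.

References: F. Bruhat, J. Tits (1972), (4.4.3); J. Tits (1979), §3.3.3; I. G. Macdonald (1995), Ch. V §2 (2.2); R. Jacobowitz (1962), §§7–8.
-/

set_option autoImplicit false
set_option linter.dupNamespace false

noncomputable section

open scoped Valued WithZero Matrix MatrixGroups
open Matrix

namespace Summit.HodgeConjecture.HodgeConjecture.Cruxes.H413.K2E3WittLeviCartanRecursionOfRawCartan

open Literature.NumberTheory.Automorphic Literature.NumberTheory.Automorphic.HermitianLattice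
open Literature.NumberTheory.Automorphic.CartanUnique
open K2E3LocalUnitaryWitt K2E3WittLeviCartanBlocks K2E3WittCartanUnramified K2E3WittLeviCartanLabels K2E3WittLeviCartanRecursionTame

/-! ## §2 The base case `S = univ`: the (trace)+(norm) Cartan decomposition of `U(σ, J₀)`, sorted -/

section Base

variable {K : Type*} [Field K] [Valued K ℤᵐ⁰] {σ : K →+* K} {ϖ : K} {N : ℕ}

/-- **SORTED CARTAN DECOMPOSITION OF `U(σ, J₀)` FROM THE RAW CARTAN LETTER**: every `g ∈ U(σ, J₀)(K)` is `k₁ · diag(d) · k₂` with `k₁, k₂ ∈ K₀ = U ∩ GL_N(𝒪)`,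
`σ(d_i) d_{rev i} = 1`, `v(d_k) = exp(−E_k)`, `E` ANTITONE and `E ∘ rev = −E` — the raw letter `hrawN` followed by conjugation
with the permutation matrix `P_τ ∈ K₀` of a `rev`-commuting `τ` sorting the valuations (★ `exists_perm_comm_rev_antitone`).
[cite: BruhatTits1972, (4.4.3)] [cite: Tits1979, §3.3.3] [cite: Jacobowitz1962, §§7–8] -/
theorem exists_unitaryInt_mul_diagonalGL_mul_of_rawCartan (hvσ : ∀ x, Valued.v (σ x) = Valued.v x)
    (hrawN : ∀ g : GL (Fin N) K, g ∈ unitaryGroupOfForm σ ((StdForm.antidiagonal N).over K) →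
      ∃ k₁ k₂ : GL (Fin N) K, k₁ ∈ unitaryGroupOfForm σ ((StdForm.antidiagonal N).over K) ∧
        (∀ i j, Valued.v ((k₁ : Matrix (Fin N) (Fin N) K) i j) ≤ 1) ∧ (∀ i j, Valued.v (((k₁⁻¹ : GL (Fin N) K) : Matrix (Fin N) (Fin N) K) i j) ≤ 1) ∧
        k₂ ∈ unitaryGroupOfForm σ ((StdForm.antidiagonal N).over K) ∧
        (∀ i j, Valued.v ((k₂ : Matrix (Fin N) (Fin N) K) i j) ≤ 1) ∧ (∀ i j, Valued.v (((k₂⁻¹ : GL (Fin N) K) : Matrix (Fin N) (Fin N) K) i j) ≤ 1) ∧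
        ∃ d : Fin N → K, ((k₁ * g * k₂ : GL (Fin N) K) : Matrix (Fin N) (Fin N) K) = Matrix.diagonal d ∧ ∀ i, σ (d i) * d (Fin.rev i) = 1)
    (g : unitaryGroupOfForm σ ((StdForm.antidiagonal N).over K)) :
    ∃ k₁ k₂ : unitaryGroupOfForm σ ((StdForm.antidiagonal N).over K),
      k₁ ∈ unitaryInt σ ((StdForm.antidiagonal N).over K) ∧ k₂ ∈ unitaryInt σ ((StdForm.antidiagonal N).over K) ∧
      ∃ (d : Fin N → Kˣ) (E : Fin N → ℤ), (∀ i, σ (d i) * d (Fin.rev i) = 1) ∧ (∀ k, Valued.v (d k : K) = WithZero.exp (-E k)) ∧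
        Antitone E ∧ (∀ i, E (Fin.rev i) = -E i) ∧ (g : GL (Fin N) K) = k₁ * diagonalGL (Fin N) K d * k₂ := by
  obtain ⟨k₁, k₂, hk₁U, hk₁, hk₁', hk₂U, hk₂, hk₂', d₀, hdiag, hnd⟩ :=
    hrawN (g : GL (Fin N) K) g.2
  -- the entries are non-zero (norm condition) with integral valuations `exp(e_k)`, `e ∘ rev = -e`
  have hd0 : ∀ i, d₀ i ≠ 0 := fun i h0 => by
    have h := hnd (Fin.rev i)
    rw [Fin.rev_rev, h0, mul_zero] at h
    exact zero_ne_one h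
  choose ex hex using fun i => exists_v_eq_exp (hd0 i)
  have hexrev : ∀ i, ex (Fin.rev i) = -ex i := fun i => by
    have h := congrArg Valued.v (hnd i)
    rw [map_mul, map_one, hvσ, hex, hex, ← WithZero.exp_add, ← WithZero.exp_zero, WithZero.exp_inj] at h
    omega
  -- the units `w`, `diag(d₀) = diagonalGL w`
  obtain ⟨w, hw⟩ : ∃ w : Fin N → Kˣ, w = fun i => Units.mk0 (d₀ i) (hd0 i) := ⟨_, rfl⟩
  have hwval : ∀ i, (w i : K) = d₀ i := fun i => by rw [hw]; rfl
  have hwn : ∀ i, σ (w i) * w (Fin.rev i) = 1 := fun i => by rw [hwval, hwval]; exact hnd i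
  have hD : k₁ * (g : GL (Fin N) K) * k₂ = diagonalGL (Fin N) K w := Units.ext (by
    rw [hdiag, coe_diagonalGL]; exact congrArg Matrix.diagonal (funext fun i => (hwval i).symm))
  -- sort by a `rev`-commuting permutation
  obtain ⟨τ, hτ, hanti, hrev⟩ := exists_perm_comm_rev_antitone (a := fun i => -ex i) (fun i => by rw [hexrev, neg_neg])
  have hτU : (permGL τ : GL (Fin N) K) ∈ unitaryGroupOfForm σ ((StdForm.antidiagonal N).over K) := permGL_mem_unitaryGroupOfForm τ hτ
  have hT : diagonalGL (Fin N) K w = (permGL τ)⁻¹ * diagonalGL (Fin N) K (w ∘ τ) * permGL τ := by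
    rw [← permGL_mul_diagonalGL_mul_permGL_inv τ w]; group
  -- the factors, as elements of `U`
  have hk₁iU : (k₁⁻¹ : GL (Fin N) K) ∈ unitaryGroupOfForm σ ((StdForm.antidiagonal N).over K) := Subgroup.inv_mem _ hk₁U
  have hk₂iU : (k₂⁻¹ : GL (Fin N) K) ∈ unitaryGroupOfForm σ ((StdForm.antidiagonal N).over K) := Subgroup.inv_mem _ hk₂U
  refine ⟨⟨k₁⁻¹, hk₁iU⟩ * (⟨permGL τ, hτU⟩)⁻¹, ⟨permGL τ, hτU⟩ * ⟨k₂⁻¹, hk₂iU⟩,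
    Subgroup.mul_mem _ (mem_unitaryInt_iff.2 ⟨fun i j => by simpa using hk₁' i j, fun i j => by simpa using hk₁ i j⟩)
      (Subgroup.inv_mem _ (permGL_mem_unitaryInt τ hτ)),
    Subgroup.mul_mem _ (permGL_mem_unitaryInt τ hτ) (mem_unitaryInt_iff.2 ⟨fun i j => by simpa using hk₂' i j, fun i j => by simpa using hk₂ i j⟩),
    w ∘ τ, fun k => -ex (τ k), fun i => ?_, fun k => ?_, hanti, hrev, ?_⟩
  · change σ (w (τ i)) * w (τ (Fin.rev i)) = 1
    rw [hτ]; exact hwn (τ i)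
  · change Valued.v (w (τ k) : K) = WithZero.exp (-(-ex (τ k)))
    rw [neg_neg, hwval]; exact hex (τ k)
  · change (g : GL (Fin N) K) = k₁⁻¹ * (permGL τ)⁻¹ * diagonalGL (Fin N) K (w ∘ τ) * (permGL τ * k₂⁻¹)
    calc (g : GL (Fin N) K) = k₁⁻¹ * (k₁ * (g : GL (Fin N) K) * k₂) * k₂⁻¹ := by group
      _ = k₁⁻¹ * ((permGL τ)⁻¹ * diagonalGL (Fin N) K (w ∘ τ) * permGL τ) * k₂⁻¹ := by rw [hD, hT]
      _ = k₁⁻¹ * (permGL τ)⁻¹ * diagonalGL (Fin N) K (w ∘ τ) * (permGL τ * k₂⁻¹) := by simp only [mul_assoc]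

end Base

/-! ## §3 The recursion -/

section Recursion

variable {K : Type*} [Field K] [Valued K ℤᵐ⁰] [IsPrincipalIdealRing (Valued.v (R := K)).valuationSubring] {σ : K →+* K} {ϖ : K}

/-- **LEVI CARTAN DECOMPOSITION FROM THE RAW CARTAN LETTER, diagonal form**: for `W = J₀` in a standard indexing `e : WittIndex r m ≃ Fin N` (`m ≤ 1`) and
every `S ⊆ Fin r`, every `g ∈ U(σ, J₀) ∩ M_S` (block diagonal for `wittBlockOn e S`) is `k₁ · diag(d) · k₂` with `k₁, k₂ ∈ U ∩ GL_N(𝒪) ∩ M_S`,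
`σ(d_i) d_{rev i} = 1`, `v(d_k) = exp(−E_k)`, `E : Fin N → ℤ` antitone on each `S`-block, `E ∘ rev = −E` (`σ` an involution preserving `v`, `ϖ` any
uniformiser, (trace), (norm); principal valuation ring).  Strong induction on `r`, peeling the first `GL` block — the (trace)+(norm) twin of ★
`K2E3WittLeviCartanRecursion.exists_leviIntegral_mul_zpowDiagGL_mul`.
[cite: BruhatTits1972, (4.4.3)] [cite: Tits1979, §3.3.3] [cite: Macdonald1995, Ch. V §2 (2.2)] [cite: Jacobowitz1962, §§7–8] -/
theorem exists_leviIntegral_mul_diagonalGL_mul_of_rawCartan (hσ : ∀ x, σ (σ x) = x) (hvσ : ∀ x, Valued.v (σ x) = Valued.v x)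
    (hϖ : Valued.v ϖ = WithZero.exp (-1 : ℤ)) (hraw : ∀ (N' : ℕ) (g : GL (Fin N') K), g ∈ unitaryGroupOfForm σ ((StdForm.antidiagonal N').over K) →
      ∃ k₁ k₂ : GL (Fin N') K, k₁ ∈ unitaryGroupOfForm σ ((StdForm.antidiagonal N').over K) ∧
        (∀ i j, Valued.v ((k₁ : Matrix (Fin N') (Fin N') K) i j) ≤ 1) ∧ (∀ i j, Valued.v (((k₁⁻¹ : GL (Fin N') K) : Matrix (Fin N') (Fin N') K) i j) ≤ 1) ∧
        k₂ ∈ unitaryGroupOfForm σ ((StdForm.antidiagonal N').over K) ∧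
        (∀ i j, Valued.v ((k₂ : Matrix (Fin N') (Fin N') K) i j) ≤ 1) ∧ (∀ i j, Valued.v (((k₂⁻¹ : GL (Fin N') K) : Matrix (Fin N') (Fin N') K) i j) ≤ 1) ∧
        ∃ d : Fin N' → K, ((k₁ * g * k₂ : GL (Fin N') K) : Matrix (Fin N') (Fin N') K) = Matrix.diagonal d ∧ ∀ i, σ (d i) * d (Fin.rev i) = 1) :
    ∀ (r : ℕ) {m N : ℕ} (_hm : m ≤ 1) (e : WittIndex r m ≃ Fin N)
      (_hstd : ∀ x, (e x).val = Sum.elim (fun i : Fin r => i.val) (Sum.elim (fun u : Fin m => r + u.val) (fun j : Fin r => r + m + j.val)) x)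
      (S : Finset (Fin r)) (g : unitaryGroupOfForm σ ((StdForm.antidiagonal N).over K))
      (_hgL : (g : GL (Fin N) K) ∈ standardLeviGL K (wittBlockOn e S)),
      ∃ k₁ k₂ : unitaryGroupOfForm σ ((StdForm.antidiagonal N).over K),
        k₁ ∈ unitaryInt σ ((StdForm.antidiagonal N).over K) ∧ (k₁ : GL (Fin N) K) ∈ standardLeviGL K (wittBlockOn e S) ∧
        k₂ ∈ unitaryInt σ ((StdForm.antidiagonal N).over K) ∧ (k₂ : GL (Fin N) K) ∈ standardLeviGL K (wittBlockOn e S) ∧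
        ∃ (d : Fin N → Kˣ) (E : Fin N → ℤ), (∀ i, σ (d i) * d (Fin.rev i) = 1) ∧ (∀ k, Valued.v (d k : K) = WithZero.exp (-E k)) ∧
          (∀ i j : Fin N, wittBlockOn e S i = wittBlockOn e S j → i ≤ j → E j ≤ E i) ∧ (∀ i, E (Fin.rev i) = -E i) ∧
          (g : GL (Fin N) K) = k₁ * diagonalGL (Fin N) K d * k₂ := by
  have hϖ0 : ϖ ≠ 0 := uniformizer_ne_zero hϖ
  intro r
  induction r using Nat.strong_induction_on with
  | _ r IH =>
  intro m N hm e hstd S g hgL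
  have hN : N = r + (m + r) := by simpa using (Fintype.card_congr e).symm
  by_cases hS : Finset.univ \ S = ∅
  · -- `S = univ`: the sorted Cartan decomposition of `U` itself (§2)
    have hSu : S = Finset.univ := Finset.univ_subset_iff.1 (Finset.sdiff_eq_empty_iff_subset.1 hS)
    subst hSu
    have hlab : ∀ i j : Fin N, wittBlockOn e (Finset.univ : Finset (Fin r)) i = wittBlockOn e Finset.univ j := fun i j => by
      rw [wittBlockOn_apply, wittBlockOn_apply, wittBlock_univ, wittBlock_univ]
    obtain ⟨k₁, k₂, hk₁, hk₂, d, E, hdn, hdv, hanti, hrev, hgk⟩ := exists_unitaryInt_mul_diagonalGL_mul_of_rawCartan hvσ (hraw N) g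
    exact ⟨k₁, k₂, hk₁, (mem_standardLeviGL_iff _ _).2 fun i j hij => absurd (hlab i j) hij, hk₂,
      (mem_standardLeviGL_iff _ _).2 fun i j hij => absurd (hlab i j) hij, d, E, hdn, hdv, fun i j _ hij => hanti hij, hrev, hgk⟩
  · -- the first break `α₀`, `c = α₀ + 1`
    have hne : (Finset.univ \ S).Nonempty := Finset.nonempty_iff_ne_empty.2 hS
    obtain ⟨α₀, hα₀mem, hα₀min⟩ : ∃ α₀ ∈ Finset.univ \ S, ∀ α ∈ Finset.univ \ S, α₀ ≤ α :=
      ⟨(Finset.univ \ S).min' hne, Finset.min'_mem _ hne, fun α hα => Finset.min'_le _ _ hα⟩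
    have hα₀ : α₀ ∉ S := (Finset.mem_sdiff.1 hα₀mem).2
    have hmin : ∀ α, α ∉ S → α₀ ≤ α := fun α hα => hα₀min α (Finset.mem_sdiff.2 ⟨Finset.mem_univ _, hα⟩)
    have hα₀r := α₀.isLt
    have hc : 2 * (α₀.val + 1) ≤ N := by omega
    have hN' : (r - (α₀.val + 1)) + (m + (r - (α₀.val + 1))) = N - 2 * (α₀.val + 1) := by omega
    have hr' : r - (α₀.val + 1) < r := by omega
    -- `g ∈ Q_c`, block diagonal
    have hgP : g ∈ blockParabolic σ N (α₀.val + 1) := mem_blockParabolic_of_mem_standardLeviGL e hstd hm hα₀ hmin hgL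
    have hgP' := mem_standardParabolicGL_toDual_of_mem_standardLeviGL e hstd hm hα₀ hmin hgL
    -- the first block (sorted `GL_c` Cartan)
    obtain ⟨κ₁, κ₂, hκ₁, hκ₂, lam, hlam, hA⟩ := exists_integral_mul_zpowDiagGL_antitone_mul hϖ (loBlockGL hc ⟨g, hgP⟩)
    -- the middle block, by induction on the shifted datum
    have hg'L := coe_midBlockU_mem_standardLeviGL e hstd hα₀ hmin hc hN' hgL hgP
    obtain ⟨κ₁', κ₂', hκ₁', hκ₁'L, hκ₂', hκ₂'L, d', E', hd'n, hd'v, hE'anti, hE'rev, hg'⟩ :=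
      IH _ hr' hm (stdWittEquivFin (r - (α₀.val + 1)) m hN') (stdWittEquivFin_hstd (r - (α₀.val + 1)) m hN')
        (Finset.univ.filter fun α' : Fin (r - (α₀.val + 1)) => (⟨α'.val + (α₀.val + 1), by have := α'.isLt; omega⟩ : Fin r) ∈ S)
        (midBlockU hc ⟨g, hgP⟩) hg'L
    -- the glued exponent function
    obtain ⟨E, hE⟩ : ∃ E : Fin N → ℤ, E = fun p => if h0 : p.val < α₀.val + 1 then lam ⟨p.val, h0⟩
        else if h1 : p.val + (α₀.val + 1) < N then E' ⟨p.val - (α₀.val + 1), by omega⟩ else -lam ⟨N - 1 - p.val, by omega⟩ := ⟨_, rfl⟩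
    have hElo : ∀ i : Fin (α₀.val + 1), E (Fin.castLE (le_of_two_mul_le hc) i) = lam i := fun i => by
      rw [hE]; dsimp only; rw [dif_pos (by exact i.isLt)]
      exact congrArg lam (Fin.ext rfl)
    have hEmid : ∀ j : Fin (N - 2 * (α₀.val + 1)), E (midIndex hc j) = E' j := fun j => by
      have hj := j.isLt
      have h1 : ¬ ((midIndex hc j).val < α₀.val + 1) := by rw [coe_midIndex]; omega
      have h2 : (midIndex hc j).val + (α₀.val + 1) < N := by rw [coe_midIndex]; omega
      rw [hE]; dsimp only; rw [dif_neg h1, dif_pos h2]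
      congr 1; apply Fin.ext; change (midIndex hc j).val - (α₀.val + 1) = j.val; rw [coe_midIndex]; omega
    have hEhi : ∀ i : Fin (α₀.val + 1), E (hiIndex hc i) = -lam (Fin.rev i) := fun i => by
      have hi := i.isLt
      have h1 : ¬ ((hiIndex hc i).val < α₀.val + 1) := by rw [coe_hiIndex]; omega
      have h2 : ¬ ((hiIndex hc i).val + (α₀.val + 1) < N) := by rw [coe_hiIndex]; omega
      rw [hE]; dsimp only; rw [dif_neg h1, dif_neg h2]
      congr 2; apply Fin.ext; change N - 1 - (hiIndex hc i).val = (Fin.rev i).val; rw [Fin.val_rev, coe_hiIndex]; omega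
    have hErev : ∀ p, E (Fin.rev p) = -E p := by
      intro p
      obtain ⟨x, rfl⟩ := (blockSum hc).surjective p
      rcases x with (i | i) | i
      · rw [blockSum_inl_inl, rev_castLE hc, hEhi, Fin.rev_rev, hElo]
      · rw [blockSum_inl_inr, rev_midIndex hc, hEmid, hEmid, hE'rev]
      · rw [blockSum_inr, rev_hiIndex hc, hElo, hEhi, neg_neg]
    have hEanti : ∀ i j : Fin N, wittBlockOn e S i = wittBlockOn e S j → i ≤ j → E j ≤ E i := by
      intro p q hlab hpq
      have hb := blockLabel_eq_of_wittBlockOn_eq e hstd hm hα₀ hmin hlab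
      obtain ⟨x, rfl⟩ := (blockSum hc).surjective p
      obtain ⟨y, rfl⟩ := (blockSum hc).surjective q
      rcases x with (i | i) | i <;> rcases y with (j | j) | j <;>
        simp only [blockSum_inl_inl, blockSum_inl_inr, blockSum_inr, blockLabel_castLE hc, blockLabel_midIndex hc, blockLabel_hiIndex hc] at hb
      all_goals first
        | exact absurd hb (by decide)
        | skip
      · rw [blockSum_inl_inl] at hpq ⊢; rw [blockSum_inl_inl] at hpq ⊢
        rw [hElo, hElo]
        exact hlam ((Fin.castLE_le_castLE_iff _).1 hpq)
      · rw [blockSum_inl_inr] at hlab hpq ⊢; rw [blockSum_inl_inr] at hlab hpq ⊢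
        rw [hEmid, hEmid]
        refine hE'anti i j (Fin.ext ?_) (Fin.le_iff_val_le_val.2 ?_)
        · have h' := congrArg Fin.val hlab
          rw [wittBlockOn_apply, wittBlockOn_apply, wittBlock_val, wittBlock_val, wittBlockNat_symm_midIndex e hstd hα₀ hmin hc hN',
            wittBlockNat_symm_midIndex e hstd hα₀ hmin hc hN'] at h'
          rw [wittBlockOn_apply, wittBlockOn_apply, wittBlock_val, wittBlock_val]
          omega
        · rw [Fin.le_iff_val_le_val, coe_midIndex, coe_midIndex] at hpq; omega
      · rw [blockSum_inr] at hpq ⊢; rw [blockSum_inr] at hpq ⊢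
        rw [hEhi, hEhi, neg_le_neg_iff]
        refine hlam (Fin.rev_le_rev.2 (Fin.le_iff_val_le_val.2 ?_))
        rw [Fin.le_iff_val_le_val, coe_hiIndex, coe_hiIndex] at hpq; omega
    -- the glued diagonal: `ϖ^{lam}` on the first block, `d'` on the middle block, and the last block FORCED BY THE NORM CONDITION
    obtain ⟨d, hd⟩ : ∃ d : Fin N → Kˣ, d = fun p => if h0 : p.val < α₀.val + 1 then Units.mk0 ϖ hϖ0 ^ lam ⟨p.val, h0⟩
        else if h1 : p.val + (α₀.val + 1) < N then d' ⟨p.val - (α₀.val + 1), by omega⟩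
        else (Units.map (σ : K →* K) (Units.mk0 ϖ hϖ0 ^ lam ⟨N - 1 - p.val, by omega⟩))⁻¹ := ⟨_, rfl⟩
    have hdlo : ∀ i : Fin (α₀.val + 1), d (Fin.castLE (le_of_two_mul_le hc) i) = Units.mk0 ϖ hϖ0 ^ lam i := fun i => by
      rw [hd]; dsimp only; rw [dif_pos (by exact i.isLt)]
      exact congrArg (fun k => Units.mk0 ϖ hϖ0 ^ lam k) (Fin.ext rfl)
    have hdmid : ∀ j : Fin (N - 2 * (α₀.val + 1)), d (midIndex hc j) = d' j := fun j => by
      have hj := j.isLt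
      have h1 : ¬ ((midIndex hc j).val < α₀.val + 1) := by rw [coe_midIndex]; omega
      have h2 : (midIndex hc j).val + (α₀.val + 1) < N := by rw [coe_midIndex]; omega
      rw [hd]; dsimp only; rw [dif_neg h1, dif_pos h2]
      congr 1; apply Fin.ext; change (midIndex hc j).val - (α₀.val + 1) = j.val; rw [coe_midIndex]; omega
    have hdhi : ∀ i : Fin (α₀.val + 1), d (hiIndex hc i) = (Units.map (σ : K →* K) (Units.mk0 ϖ hϖ0 ^ lam (Fin.rev i)))⁻¹ := fun i => by
      have hi := i.isLt
      have h1 : ¬ ((hiIndex hc i).val < α₀.val + 1) := by rw [coe_hiIndex]; omega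
      have h2 : ¬ ((hiIndex hc i).val + (α₀.val + 1) < N) := by rw [coe_hiIndex]; omega
      rw [hd]; dsimp only; rw [dif_neg h1, dif_neg h2]
      have hidx : (⟨N - 1 - (hiIndex hc i).val, by rw [coe_hiIndex]; omega⟩ : Fin (α₀.val + 1)) = Fin.rev i :=
        Fin.ext (by change N - 1 - (hiIndex hc i).val = (Fin.rev i).val; rw [Fin.val_rev, coe_hiIndex]; omega)
      rw [hidx]
    -- the norm condition of the glued diagonal
    have hdn : ∀ p, σ (d p) * d (Fin.rev p) = 1 := by
      intro p
      obtain ⟨x, rfl⟩ := (blockSum hc).surjective p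
      rcases x with (i | i) | i
      · rw [blockSum_inl_inl, rev_castLE hc, hdhi, Fin.rev_rev, hdlo,
          show σ ((Units.mk0 ϖ hϖ0 ^ lam i : Kˣ) : K) = ((Units.map (σ : K →* K) (Units.mk0 ϖ hϖ0 ^ lam i) : Kˣ) : K) from rfl,
          ← Units.val_mul, mul_inv_cancel, Units.val_one]
      · rw [blockSum_inl_inr, rev_midIndex hc, hdmid, hdmid]; exact hd'n i
      · rw [blockSum_inr, rev_hiIndex hc, hdhi, hdlo, Units.val_inv_eq_inv_val,
          show ((Units.map (σ : K →* K) (Units.mk0 ϖ hϖ0 ^ lam (Fin.rev i)) : Kˣ) : K) = σ ((Units.mk0 ϖ hϖ0 ^ lam (Fin.rev i) : Kˣ) : K) from rfl,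
          map_inv₀, hσ, inv_mul_cancel₀ (Units.ne_zero _)]
    -- the valuations of the glued diagonal
    have hdv : ∀ p, Valued.v (d p : K) = WithZero.exp (-E p) := by
      intro p
      obtain ⟨x, rfl⟩ := (blockSum hc).surjective p
      rcases x with (i | i) | i
      · rw [blockSum_inl_inl, hdlo, hElo, Units.val_zpow_eq_zpow_val, Units.val_mk0, v_uniformizer_zpow hϖ]
      · rw [blockSum_inl_inr, hdmid, hEmid]; exact hd'v i
      · rw [blockSum_inr, hdhi, hEhi, neg_neg, Units.val_inv_eq_inv_val,
          show ((Units.map (σ : K →* K) (Units.mk0 ϖ hϖ0 ^ lam (Fin.rev i)) : Kˣ) : K) = σ ((Units.mk0 ϖ hϖ0 ^ lam (Fin.rev i) : Kˣ) : K) from rfl,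
          map_inv₀, hvσ, Units.val_zpow_eq_zpow_val, Units.val_mk0, v_uniformizer_zpow hϖ, ← WithZero.exp_neg, neg_neg]
    -- the three factors `k₁ = diag(κ₁, κ₁′, κ₁†)`, `D = diag(d)`, `k₂ = diag(κ₂, κ₂′, κ₂†)`
    have hk₁P : blockDiagLift hσ hc κ₁ κ₁' ∈ blockParabolic σ N (α₀.val + 1) := blockDiagLift_mem_blockParabolic hσ hc κ₁ κ₁'
    have hk₂P : blockDiagLift hσ hc κ₂ κ₂' ∈ blockParabolic σ N (α₀.val + 1) := blockDiagLift_mem_blockParabolic hσ hc κ₂ κ₂'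
    have hDP : (⟨diagonalGL (Fin N) K d, diagonalGL_mem_unitaryGroupOfForm_of_norm hdn⟩ :
        unitaryGroupOfForm σ ((StdForm.antidiagonal N).over K)) ∈ blockParabolic σ N (α₀.val + 1) :=
      diagonalGL_mem_blockParabolic hc hdn
    -- the product `k₁ D k₂` inside `Q_c`
    have hprodP' : ((((⟨blockDiagLift hσ hc κ₁ κ₁', hk₁P⟩ : blockParabolic σ N (α₀.val + 1)) *
        ⟨⟨diagonalGL (Fin N) K d, diagonalGL_mem_unitaryGroupOfForm_of_norm hdn⟩, hDP⟩ * ⟨blockDiagLift hσ hc κ₂ κ₂', hk₂P⟩ :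
          blockParabolic σ N (α₀.val + 1)) : unitaryGroupOfForm σ ((StdForm.antidiagonal N).over K)) : GL (Fin N) K) ∈
        standardParabolicGL K (OrderDual.toDual ∘ blockLabel N (α₀.val + 1)) := by
      rw [Subgroup.coe_mul, Subgroup.coe_mul, Subgroup.coe_mul, Subgroup.coe_mul]
      exact Subgroup.mul_mem _ (Subgroup.mul_mem _ (coe_blockDiagLift_mem_standardParabolicGL_toDual hσ hc κ₁ κ₁')
        (diagonalGL_mem_standardParabolicGL _ d)) (coe_blockDiagLift_mem_standardParabolicGL_toDual hσ hc κ₂ κ₂')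
    have hlamD : zpowDiagGL (uniformizer_ne_zero hϖ) lam = diagonalGL (Fin (α₀.val + 1)) K (d ∘ Fin.castLE (le_of_two_mul_le hc)) := by
      rw [show d ∘ Fin.castLE (le_of_two_mul_le hc) = fun i => Units.mk0 ϖ hϖ0 ^ lam i from funext hdlo]; rfl
    -- the equation, by rigidity
    have heq : g = (((⟨blockDiagLift hσ hc κ₁ κ₁', hk₁P⟩ : blockParabolic σ N (α₀.val + 1)) *
        ⟨⟨diagonalGL (Fin N) K d, diagonalGL_mem_unitaryGroupOfForm_of_norm hdn⟩, hDP⟩ * ⟨blockDiagLift hσ hc κ₂ κ₂', hk₂P⟩ :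
          blockParabolic σ N (α₀.val + 1)) : unitaryGroupOfForm σ ((StdForm.antidiagonal N).over K)) := by
      refine eq_of_loBlockGL_eq_of_midBlockU_eq hc hgP hgP' (Subtype.prop _) hprodP' ?_ ?_
      · change loBlockGL hc ⟨g, hgP⟩ = loBlockGL hc ((⟨blockDiagLift hσ hc κ₁ κ₁', hk₁P⟩ : blockParabolic σ N (α₀.val + 1)) *
          ⟨⟨diagonalGL (Fin N) K d, diagonalGL_mem_unitaryGroupOfForm_of_norm hdn⟩, hDP⟩ * ⟨blockDiagLift hσ hc κ₂ κ₂', hk₂P⟩)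
        rw [map_mul, map_mul, loBlockGL_blockDiagLift, loBlockGL_blockDiagLift, loBlockGL_diagonalGL hc hdn, hA, hlamD]
      · change midBlockU hc ⟨g, hgP⟩ = midBlockU hc ((⟨blockDiagLift hσ hc κ₁ κ₁', hk₁P⟩ : blockParabolic σ N (α₀.val + 1)) *
          ⟨⟨diagonalGL (Fin N) K d, diagonalGL_mem_unitaryGroupOfForm_of_norm hdn⟩, hDP⟩ * ⟨blockDiagLift hσ hc κ₂ κ₂', hk₂P⟩)
        rw [map_mul, map_mul, midBlockU_blockDiagLift, midBlockU_blockDiagLift]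
        refine Subtype.ext ?_
        rw [hg', Subgroup.coe_mul, Subgroup.coe_mul]
        congr 2
        refine Units.ext ?_
        rw [coe_diagonalGL, coe_midBlockU_diagonalGL hc hdn]
        congr 1
        funext j
        rw [hdmid]
    refine ⟨_, _, blockDiagLift_mem_unitaryInt hσ hvσ hc hκ₁.1 hκ₁.2.1 hκ₁',
      coe_blockDiagLift_mem_standardLeviGL e hstd hm hα₀ hmin hσ hc hN' κ₁ hκ₁'L,
      blockDiagLift_mem_unitaryInt hσ hvσ hc hκ₂.1 hκ₂.2.1 hκ₂',
      coe_blockDiagLift_mem_standardLeviGL e hstd hm hα₀ hmin hσ hc hN' κ₂ hκ₂'L, d, E, hdn, hdv, hEanti, hErev, ?_⟩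
    have h := congrArg (fun x : unitaryGroupOfForm σ ((StdForm.antidiagonal N).over K) => (x : GL (Fin N) K)) heq
    simp only [Subgroup.coe_mul] at h
    exact h

end Recursion

end Summit.HodgeConjecture.HodgeConjecture.Cruxes.H413.K2E3WittLeviCartanRecursionOfRawCartan

end
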